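import Summits.HodgeConjecture.HodgeConjecture.Theorems.F0P3cStCharTSEllInnerGRegroup      -- ★ (E0) p852642∕p852664 (LH6-p03): brings ★ (E0a) `ncard_setOf_isConj_apply_eq_{zero_of_ne,index}`, `integral_eq_integral_comp_of_conj_into`, ★ (E0-count), ★ (P3) `exists_finset_mem_isConj_card_eq_index_centralizerH`, ★ UP-EVAL
import Summits.HodgeConjecture.HodgeConjecture.Theorems.F0P3cStCharTSUpTrSlotTransport     -- ★ (U1) p852935 (this seat): `sq_mul_inv_mul_mul`; brings ★ (F2)∕(P2) `stableOrbitalIntegralRel` currency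
import HarnessLib

/-!
# F0 · P3c · ROAD «UP-TR» (A1″) «UP-TR-FULL», FILE U2 «SPLIT SLOT»: the split-torus term of the up-transfer identity WITHOUT local boundedness —
# `[N_G(M):M]⁻¹ ∫_M D_G² · α^G · Φ_G(·, f) = [N_H(M_H):M_H]⁻¹ (m M_H)⁻¹ ∫_{M_H} D_H² · α · Φ^st_H(·, f^H)` from the density at the split member, (E0a) and (P2)
# (Rogawski 1990 §12.5 pp. 182–185, Lemma 12.5.1; §4.3 (4.3.1))

Cell `pub/hodgecm-mathlib`, crux H413 = `stmt-HodgeConjecture-24833` (lane `--supports … --as helper`, count-neutral); seat F0P2-p01 (g25) ((A1″) pen; (U2) handed back by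
F0P3-p02 (g25) 2026-09-02T23:11:32Z; LEAD F0P3a-plan (g16) T15-04 «GO-LOW»; WANTS-U2 `F0/P2/p01/g25/u2/WANTS-U2-SplitSlot.v1.F0P2p01g25.md` f46ea0ce4728cb96).
THEOREMS ONLY (no definition ∕ instance ∕ notation ∕ named fact ∕ `sorry`); ★-only imports; axioms TRIO.

THE MATHEMATICS.  `G = U(Φ₃)(L⁺_v)`, `H_v = U(Φ₂) × U(Φ₁)`, `v` non-split; `M = Z_G(m₀)` the split Cartan of `G` (a member of the system `C ∋ M` of ★ CARTAN-ALL, the other members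
compact, `hncC`∕`hcovC` in ★ INSTANTIATE-CARTAN's letters); `M_H ∈ SH` the split member of the ALL-SHAPES `H`-Cartan system ★ (H1′) (the others compact; `hcomplete`∕`hirred` for ALL
`G`-regular elements; the (X2) embedding package `n γc eT heT ψ hψ fib hfib hψR hψuniq`, the (H6a′) count `m`).  The stable norm fibre over the split member is ONE class (`hone`, BY
SHAPE — the `U(Φ₁)`-slot of a `G`-regular element matching a hyperbolic class is forced).  Then, for the `G`-torus integrand `Ψ = dG² · α^G · Φ_G(⟦·⟧, f)` (ABSTRACT `dG`, `dH` as
★ (A1′)-E ∕ ★ (E8) ∕ ★ (U1); `α^G` = (UP-DEF) inline):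
(1) DENSITY AT THE SPLIT MEMBER: at a regular `x ∈ M`, `Σ_{T ∈ SH} [N_H(T):T]⁻¹ (m T)⁻¹ Σ_i #{s ∈ T ∣ e_{T,i} s ∼ x} = 1` (★ (E0-count) `weighted_fibre_card_eq_one` on the all-shapes
system at the SINGLETON transversal, `c ≡ 1`), and the compact members contribute nothing (their embeddings land in compact Cartans, ★ (E0a) `ncard_setOf_isConj_apply_eq_zero_of_ne`),
so `Ψ x = [N_H(M_H):M_H]⁻¹ (m M_H)⁻¹ Σ_i #{s ∈ M_H ∣ e_i s ∼ x} · Ψ x` on `M`;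
(2) (E0a) per embedding: `[N_G(M):M]⁻¹ ∫_M #{…}·Ψ dμM = ∫_{M_H} Ψ ∘ e_i dtT` (★ `ncard_setOf_isConj_apply_eq_index`, ★ `integral_eq_integral_comp_of_conj_into` — every `Z_G(γc M_H i)`
lands in `M`, being non-compact);
(3) POINTWISE at a `G`-regular `s ∈ M_H`: UP-EVAL on the singleton transversal `{s}` (★ `finsum_upSummand_eq_sum`) gives `α^G(e_i s) = dG(e_i s)⁻¹ · τ(s) dH(s) κ(s, e_i s) α(s)`, so
`Σ_i Ψ(e_i s) = Σ_i dG(e_i s) · (τ dH κ α)(s) · Φ_G(⟦e_i s⟧, f) = dH(s)² α(s) Φ^st_H(s, f^H)` by (P2) (`hP2`, ★ (F2)'s shape) — a.e. on `M_H` (`hsingMH`).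
* `splitTorus_upIntegrand_eq_of_inputs` — the statement above from its named inputs BY SHAPE (= the WANTS-U2 head; the (U3) head discharges every letter by ★ name).
HONEST LABEL: count-neutral helper toward (A1″); closes no organ; the UP-TR block consequent left the organ at ED. 26 on the LB reading; HC_CM is proved only modulo the printed
citations (hLiu418 24832 ∕ h413 24833) until rung 0 closes.

## References
* [Rogawski1990] J. D. Rogawski, *Automorphic Representations of Unitary Groups in Three Variables*, Ann. of Math. Stud. 123 (1990): §12.5 pp. 182–185 (Weyl integration, the
  `δ`-count p. 182, Lemma 12.5.1 and its proof), §3.6 pp. 28–31 (the split Cartan subgroups), §4.3 (4.3.1) p. 43, §4.9 p. 55.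
* [HarishChandra1970] Harish-Chandra (notes by G. van Dijk), *Harmonic analysis on reductive p-adic groups*, LNM 162 (1970), Part V §4 Lemma 42.
* [LanglandsShelstad1987] R. P. Langlands, D. Shelstad, *On the definition of transfer factors*, Math. Ann. 278 (1987), §1.3.
-/

set_option autoImplicit false
-- the mandated namespace has the single-problem summit's repeated segment (`HodgeConjecture.HodgeConjecture`)
set_option linter.dupNamespace false

noncomputable section

open MeasureTheory Measure Set Filter Topology Function NumberField IsDedekindDomain Matrix
open Literature.MeasureTheory.Group
open Literature.NumberTheory.Automorphic Literature.NumberTheory.Automorphic.UnitaryGroup Literature.NumberTheory.Rogawski1990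
open Literature.NumberTheory.GaloisRepresentations
open Summit.HodgeConjecture.HodgeConjecture.Cruxes.H413
open Summit.HodgeConjecture.HodgeConjecture.Cruxes.H413.F0P3cStCharTSWeylCartanRadial
open Summit.HodgeConjecture.HodgeConjecture.Cruxes.H413.F0P3cStCharTSEllInnerTorusExchange
open Summit.HodgeConjecture.HodgeConjecture.Cruxes.H413.F0P3cStCharTSUpTrExchange
open Summit.HodgeConjecture.HodgeConjecture.Cruxes.H413.F0P3cStCharTSUpTrClaimP
open Summit.HodgeConjecture.HodgeConjecture.Cruxes.H413.F0P3cStCharTSUpEval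
open scoped ENNReal NNReal MatrixGroups Pointwise Classical

namespace Summit.HodgeConjecture.HodgeConjecture.Cruxes.H413.F0P3cStCharTSUpTrSplitSlot

section CM

variable (L : Type) [Field L] [NumberField L] [IsCMField L] (v : HeightOneSpectrum (𝓞 ↥(maximalRealSubfield L)))

/-! ## §1 A conjugate of a compact subgroup is compact (membership form) -/

/-- If `∀ g, g ∈ Z ↔ y⁻¹ g y ∈ T₀` then `Z` is the image of `T₀` under `t ↦ y t y⁻¹`; so `Z` is compact when `T₀` is. [folklore] -/
theorem isCompact_of_forall_mem_iff_conj {G : Type*} [Group G] [TopologicalSpace G] [IsTopologicalGroup G] {Z T₀ : Subgroup G} (y : G)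
    (hy : ∀ g : G, g ∈ Z ↔ y⁻¹ * g * y ∈ T₀) (hT₀ : IsCompact (T₀ : Set G)) : IsCompact (Z : Set G) := by
  have himage : (fun t : G => y * t * y⁻¹) '' (T₀ : Set G) = (Z : Set G) := by
    ext g
    simp only [Set.mem_image, SetLike.mem_coe]
    constructor
    · rintro ⟨t, ht, rfl⟩
      exact (hy _).2 (by rw [show y⁻¹ * (y * t * y⁻¹) * y = t by group]; exact ht)
    · intro hg
      exact ⟨y⁻¹ * g * y, (hy g).1 hg, by group⟩
  rw [← himage]
  exact hT₀.image (by fun_prop)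

/-! ## §2 The split-torus term from named inputs -/

set_option maxHeartbeats 3200000 in
set_option synthInstance.maxHeartbeats 400000 in
-- long statement; instance-term unification on the CM local carriers (class of ★ (A1′)-E ∕ ★ (E0))
/-- **(A1″)-U2 «SPLIT SLOT» — the split-torus term of the up-transfer identity, from named inputs.**  Letters: ★ (A1′)-E∕(E8)∕(U1)'s `dG hdG dH hDHst`; the ALL-SHAPES `H`-Cartan system
`SH` of ★ (H1′) with its (X2) package and (H6a′) count (`n γc hγc eT heT ψ hψ fib hfib hZ hcomplete hirred m hclasses hψR hψuniq`), its split member `MH ∈ SH` (`hMHnc`: not compact; `hcpt`: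
the others compact) with Haar measure `tT` (its `G`-singular part null, `hsingMH`); the `G`-side representatives `C ∋ M = Z_G(m₀)` (★ INSTANTIATE-CARTAN letters `hcptC hcovC hncC`, `hMnc`)
with THE core-one Haar measures `μM` on `M` and `tT` on `MH`; the SINGLETON stable fibre over the split member (`hone`, BY SHAPE); (P2) at `MH` (`hP2`, ★ (F2)'s shape); the GIVEN
`G`-side torus integrand integrable on `M` (`hIGM`).  THEN
`([N_G(M):M] : ℂ)⁻¹ · ∫_M dG² · α^G · Φ_G(⟦·⟧, f) ∂μM = ([N_H(MH):MH] : ℂ)⁻¹ (m MH : ℂ)⁻¹ · ∫_{MH} dH² · α · Φ^st_H(·, f^H) ∂tT`, `α^G` = (UP-DEF) inline.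
[cite: Rogawski1990, §12.5 pp. 182–185, Lemma 12.5.1; §4.3 (4.3.1) p. 43] [cite: HarishChandra1970, Lemma 42] [cite: LanglandsShelstad1987, §1.3] -/
theorem splitTorus_upIntegrand_eq_of_inputs
    (hns : ∀ w : PlacesOver L v, IsCMField.complexConj L • w.1 = w.1)
    [MeasurableSpace (Gqs L v)] [BorelSpace (Gqs L v)] [LocallyCompactSpace (Gqs L v)] [SecondCountableTopology (Gqs L v)] [T2Space (Gqs L v)]
    [∀ γ' : Gqs L v, MeasurableSpace (Gqs L v ⧸ Subgroup.centralizer ({γ'} : Set (Gqs L v)))]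
    [MeasurableSpace ((UnitaryGroup.cmDatum L 2 (Matrix.of fun i j : Fin 2 => if i.val + j.val + 1 = 2 then (1 : L) else 0)).Local v × (UnitaryGroup.cmDatum L 1 (Matrix.of fun i j : Fin 1 => if i.val + j.val + 1 = 1 then (1 : L) else 0)).Local v)] [BorelSpace ((UnitaryGroup.cmDatum L 2 (Matrix.of fun i j : Fin 2 => if i.val + j.val + 1 = 2 then (1 : L) else 0)).Local v × (UnitaryGroup.cmDatum L 1 (Matrix.of fun i j : Fin 1 => if i.val + j.val + 1 = 1 then (1 : L) else 0)).Local v)]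
    [∀ a : ((UnitaryGroup.cmDatum L 2 (Matrix.of fun i j : Fin 2 => if i.val + j.val + 1 = 2 then (1 : L) else 0)).Local v × (UnitaryGroup.cmDatum L 1 (Matrix.of fun i j : Fin 1 => if i.val + j.val + 1 = 1 then (1 : L) else 0)).Local v), MeasurableSpace (((UnitaryGroup.cmDatum L 2 (Matrix.of fun i j : Fin 2 => if i.val + j.val + 1 = 2 then (1 : L) else 0)).Local v × (UnitaryGroup.cmDatum L 1 (Matrix.of fun i j : Fin 1 => if i.val + j.val + 1 = 1 then (1 : L) else 0)).Local v) ⧸ Subgroup.centralizer ({a} : Set ((UnitaryGroup.cmDatum L 2 (Matrix.of fun i j : Fin 2 => if i.val + j.val + 1 = 2 then (1 : L) else 0)).Local v × (UnitaryGroup.cmDatum L 1 (Matrix.of fun i j : Fin 1 => if i.val + j.val + 1 = 1 then (1 : L) else 0)).Local v)))]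
    (μ : HeckeCharacter L)
    -- the closed forms, abstract
    (dG : Gqs L v → ℝ) (hdG : ∀ h g : Gqs L v, dG (h * g * h⁻¹) = dG g)
    (dH : ((UnitaryGroup.cmDatum L 2 (Matrix.of fun i j : Fin 2 => if i.val + j.val + 1 = 2 then (1 : L) else 0)).Local v × (UnitaryGroup.cmDatum L 1 (Matrix.of fun i j : Fin 1 => if i.val + j.val + 1 = 1 then (1 : L) else 0)).Local v) → ℝ) (hDHst : ∀ a b, IsLocalGRegular L v a → IsLocalStablyConjH L v a b → dH b = dH a)
    -- the ALL-SHAPES `H`-Cartan system with embeddings (★ (H1′), ★ (X2) letters)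
    (SH : Finset (Subgroup ((UnitaryGroup.cmDatum L 2 (Matrix.of fun i j : Fin 2 => if i.val + j.val + 1 = 2 then (1 : L) else 0)).Local v × (UnitaryGroup.cmDatum L 1 (Matrix.of fun i j : Fin 1 => if i.val + j.val + 1 = 1 then (1 : L) else 0)).Local v))) (n : Subgroup ((UnitaryGroup.cmDatum L 2 (Matrix.of fun i j : Fin 2 => if i.val + j.val + 1 = 2 then (1 : L) else 0)).Local v × (UnitaryGroup.cmDatum L 1 (Matrix.of fun i j : Fin 1 => if i.val + j.val + 1 = 1 then (1 : L) else 0)).Local v) → ℕ)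
    (γc : (T : Subgroup ((UnitaryGroup.cmDatum L 2 (Matrix.of fun i j : Fin 2 => if i.val + j.val + 1 = 2 then (1 : L) else 0)).Local v × (UnitaryGroup.cmDatum L 1 (Matrix.of fun i j : Fin 1 => if i.val + j.val + 1 = 1 then (1 : L) else 0)).Local v)) → Fin (n T) → Gqs L v) (hγc : ∀ T ∈ SH, ∀ i : Fin (n T), IsRegularElt ((γc T i).val : GL (Fin 3) (UnitaryGroup.LocalRing L v)))
    (eT : (T : Subgroup ((UnitaryGroup.cmDatum L 2 (Matrix.of fun i j : Fin 2 => if i.val + j.val + 1 = 2 then (1 : L) else 0)).Local v × (UnitaryGroup.cmDatum L 1 (Matrix.of fun i j : Fin 1 => if i.val + j.val + 1 = 1 then (1 : L) else 0)).Local v)) → (i : Fin (n T)) → (↥T ≃ₜ* ↥(Subgroup.centralizer ({γc T i} : Set (Gqs L v)))))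
    (heT : ∀ T ∈ SH, ∀ (i : Fin (n T)) (s : ↥T), IsLocalNormPair L (qsForm L) v s.1 ((eT T i s : ↥(Subgroup.centralizer ({γc T i} : Set (Gqs L v)))) : Gqs L v))
    (ψ : (T : Subgroup ((UnitaryGroup.cmDatum L 2 (Matrix.of fun i j : Fin 2 => if i.val + j.val + 1 = 2 then (1 : L) else 0)).Local v × (UnitaryGroup.cmDatum L 1 (Matrix.of fun i j : Fin 1 => if i.val + j.val + 1 = 1 then (1 : L) else 0)).Local v)) → Fin (n T) → ((UnitaryGroup.cmDatum L 2 (Matrix.of fun i j : Fin 2 => if i.val + j.val + 1 = 2 then (1 : L) else 0)).Local v × (UnitaryGroup.cmDatum L 1 (Matrix.of fun i j : Fin 1 => if i.val + j.val + 1 = 1 then (1 : L) else 0)).Local v) → Gqs L v) (hψ : ∀ T ∈ SH, ∀ (i : Fin (n T)) (s : ↥T), ψ T i s.1 = ((eT T i s : ↥(Subgroup.centralizer ({γc T i} : Set (Gqs L v)))) : Gqs L v))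
    (fib : Gqs L v → (T : Subgroup ((UnitaryGroup.cmDatum L 2 (Matrix.of fun i j : Fin 2 => if i.val + j.val + 1 = 2 then (1 : L) else 0)).Local v × (UnitaryGroup.cmDatum L 1 (Matrix.of fun i j : Fin 1 => if i.val + j.val + 1 = 1 then (1 : L) else 0)).Local v)) → Fin (n T) → Finset ((UnitaryGroup.cmDatum L 2 (Matrix.of fun i j : Fin 2 => if i.val + j.val + 1 = 2 then (1 : L) else 0)).Local v × (UnitaryGroup.cmDatum L 1 (Matrix.of fun i j : Fin 1 => if i.val + j.val + 1 = 1 then (1 : L) else 0)).Local v))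
    (hfib : ∀ g : Gqs L v, ∀ T ∈ SH, ∀ (i : Fin (n T)) (x : ((UnitaryGroup.cmDatum L 2 (Matrix.of fun i j : Fin 2 => if i.val + j.val + 1 = 2 then (1 : L) else 0)).Local v × (UnitaryGroup.cmDatum L 1 (Matrix.of fun i j : Fin 1 => if i.val + j.val + 1 = 1 then (1 : L) else 0)).Local v)), x ∈ fib g T i ↔ x ∈ T ∧ IsLocalGRegular L v x ∧ IsConj (ψ T i x) g)
    (hZ : ∀ T ∈ SH, ∃ γ₀ : ((UnitaryGroup.cmDatum L 2 (Matrix.of fun i j : Fin 2 => if i.val + j.val + 1 = 2 then (1 : L) else 0)).Local v × (UnitaryGroup.cmDatum L 1 (Matrix.of fun i j : Fin 1 => if i.val + j.val + 1 = 1 then (1 : L) else 0)).Local v), IsLocalGRegular L v γ₀ ∧ T = Subgroup.centralizer ({γ₀} : Set ((UnitaryGroup.cmDatum L 2 (Matrix.of fun i j : Fin 2 => if i.val + j.val + 1 = 2 then (1 : L) else 0)).Local v × (UnitaryGroup.cmDatum L 1 (Matrix.of fun i j : Fin 1 => if i.val + j.val + 1 = 1 then (1 : L) else 0)).Local v)))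
    (hcomplete : ∀ h : ((UnitaryGroup.cmDatum L 2 (Matrix.of fun i j : Fin 2 => if i.val + j.val + 1 = 2 then (1 : L) else 0)).Local v × (UnitaryGroup.cmDatum L 1 (Matrix.of fun i j : Fin 1 => if i.val + j.val + 1 = 1 then (1 : L) else 0)).Local v), IsLocalGRegular L v h → ∃ T ∈ SH, ∃ s ∈ T, IsConj h s)
    (hirred : ∀ T ∈ SH, ∀ T' ∈ SH, ∀ s ∈ T, ∀ s' ∈ T', IsLocalGRegular L v s → IsConj s s' → T = T')
    (m : Subgroup ((UnitaryGroup.cmDatum L 2 (Matrix.of fun i j : Fin 2 => if i.val + j.val + 1 = 2 then (1 : L) else 0)).Local v × (UnitaryGroup.cmDatum L 1 (Matrix.of fun i j : Fin 1 => if i.val + j.val + 1 = 1 then (1 : L) else 0)).Local v) → ℕ)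
    (hclasses : ∀ T ∈ SH, ∀ s ∈ T, IsLocalGRegular L v s →
      ∃ C : Finset ((UnitaryGroup.cmDatum L 2 (Matrix.of fun i j : Fin 2 => if i.val + j.val + 1 = 2 then (1 : L) else 0)).Local v × (UnitaryGroup.cmDatum L 1 (Matrix.of fun i j : Fin 1 => if i.val + j.val + 1 = 1 then (1 : L) else 0)).Local v), (∀ x ∈ C, IsLocalStablyConjH L v s x) ∧ (∀ x ∈ C, ∀ y ∈ C, IsConj x y → x = y) ∧ (∀ y, IsLocalStablyConjH L v s y → ∃ x ∈ C, IsConj y x) ∧ C.card = m T)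
    (hψR : ∀ T ∈ SH, ∀ (i : Fin (n T)), ∀ s ∈ T, IsLocalGRegular L v s → IsLocalNormPair L (qsForm L) v s (ψ T i s))
    (hψuniq : ∀ T ∈ SH, ∀ s ∈ T, IsLocalGRegular L v s → ∀ g : Gqs L v, IsLocalNormPair L (qsForm L) v s g → ∃! i : Fin (n T), IsConj (ψ T i s) g)
    -- the split member `MH ∈ SH` (not compact; the others compact), its Haar measure with null `G`-singular part
    {MH : Subgroup ((UnitaryGroup.cmDatum L 2 (Matrix.of fun i j : Fin 2 => if i.val + j.val + 1 = 2 then (1 : L) else 0)).Local v × (UnitaryGroup.cmDatum L 1 (Matrix.of fun i j : Fin 1 => if i.val + j.val + 1 = 1 then (1 : L) else 0)).Local v)} (hMH : MH ∈ SH) (hMHnc : ¬ IsCompact (MH : Set ((UnitaryGroup.cmDatum L 2 (Matrix.of fun i j : Fin 2 => if i.val + j.val + 1 = 2 then (1 : L) else 0)).Local v × (UnitaryGroup.cmDatum L 1 (Matrix.of fun i j : Fin 1 => if i.val + j.val + 1 = 1 then (1 : L) else 0)).Local v))) (hcpt : ∀ T ∈ SH, T ≠ MH → IsCompact (T : Set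 ((UnitaryGroup.cmDatum L 2 (Matrix.of fun i j : Fin 2 => if i.val + j.val + 1 = 2 then (1 : L) else 0)).Local v × (UnitaryGroup.cmDatum L 1 (Matrix.of fun i j : Fin 1 => if i.val + j.val + 1 = 1 then (1 : L) else 0)).Local v)))
    (tT : Measure ↥MH) [tT.IsHaarMeasure] (htT : tT (compactCore ↥MH) = 1)
    (hsingMH : tT {s : ↥MH | ¬ IsLocalGRegular L v (s : ((UnitaryGroup.cmDatum L 2 (Matrix.of fun i j : Fin 2 => if i.val + j.val + 1 = 2 then (1 : L) else 0)).Local v × (UnitaryGroup.cmDatum L 1 (Matrix.of fun i j : Fin 1 => if i.val + j.val + 1 = 1 then (1 : L) else 0)).Local v))} = 0)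
    -- the `G`-side: the split Cartan `M = Z_G(m₀)` inside the representatives `C` (★ INSTANTIATE-CARTAN letters), THE core-one Haar measure on `M`
    (C : Finset (Subgroup (Gqs L v))) {M : Subgroup (Gqs L v)} (hMC : M ∈ C) {m₀ : Gqs L v} (hm₀ : IsRegularElt (m₀.val : GL (Fin 3) (UnitaryGroup.LocalRing L v)))
    (hM : M = Subgroup.centralizer ({m₀} : Set (Gqs L v))) (hMnc : ¬ IsCompact (M : Set (Gqs L v)))
    (hcptC : ∀ T' ∈ C, T' ≠ M → IsCompact (T' : Set (Gqs L v)))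
    (hcovC : ∀ γ : Gqs L v, IsRegularElt (γ.val : GL (Fin 3) (UnitaryGroup.LocalRing L v)) → ∃ T' ∈ C, ∃ x : Gqs L v, ∀ g : Gqs L v, g ∈ Subgroup.centralizer ({γ} : Set (Gqs L v)) ↔ x⁻¹ * g * x ∈ T')
    (hncC : ∀ T' ∈ C, ∀ T'' ∈ C, T' ≠ T'' → ∀ y : Gqs L v, ¬ ∀ h : Gqs L v, h ∈ T'' ↔ y⁻¹ * h * y ∈ T')
    (μM : Measure ↥M) [μM.IsHaarMeasure] (hμM : μM (compactCore ↥M) = 1)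
    -- the SINGLETON stable fibre over the split member (BY SHAPE)
    (hone : ∀ s ∈ MH, IsLocalGRegular L v s → ∀ a : ((UnitaryGroup.cmDatum L 2 (Matrix.of fun i j : Fin 2 => if i.val + j.val + 1 = 2 then (1 : L) else 0)).Local v × (UnitaryGroup.cmDatum L 1 (Matrix.of fun i j : Fin 1 => if i.val + j.val + 1 = 1 then (1 : L) else 0)).Local v), IsLocalGRegular L v a → ∀ γ : Gqs L v,
      IsLocalNormPair L (qsForm L) v s γ → IsLocalNormPair L (qsForm L) v a γ → IsLocalStablyConjH L v a s)
    -- the analytic data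
    (mQv : OrbitalMeasureFamily (Gqs L v)) (f : Gqs L v → ℂ)
    (mHv : OrbitalMeasureFamily ((UnitaryGroup.cmDatum L 2 (Matrix.of fun i j : Fin 2 => if i.val + j.val + 1 = 2 then (1 : L) else 0)).Local v × (UnitaryGroup.cmDatum L 1 (Matrix.of fun i j : Fin 1 => if i.val + j.val + 1 = 1 then (1 : L) else 0)).Local v)) (fH : ((UnitaryGroup.cmDatum L 2 (Matrix.of fun i j : Fin 2 => if i.val + j.val + 1 = 2 then (1 : L) else 0)).Local v × (UnitaryGroup.cmDatum L 1 (Matrix.of fun i j : Fin 1 => if i.val + j.val + 1 = 1 then (1 : L) else 0)).Local v) → ℂ)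
    (α : ((UnitaryGroup.cmDatum L 2 (Matrix.of fun i j : Fin 2 => if i.val + j.val + 1 = 2 then (1 : L) else 0)).Local v × (UnitaryGroup.cmDatum L 1 (Matrix.of fun i j : Fin 1 => if i.val + j.val + 1 = 1 then (1 : L) else 0)).Local v) → ℂ) (hαst : Ch12Sec5.IsStableClassFunOn (IsLocalStablyConjH L v) {a : ((UnitaryGroup.cmDatum L 2 (Matrix.of fun i j : Fin 2 => if i.val + j.val + 1 = 2 then (1 : L) else 0)).Local v × (UnitaryGroup.cmDatum L 1 (Matrix.of fun i j : Fin 1 => if i.val + j.val + 1 = 1 then (1 : L) else 0)).Local v) | IsLocalGRegular L v a} α)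
    -- (P2) at `MH` (★ (F2)'s shape)
    (hP2 : ∀ s : ↥MH, IsLocalGRegular L v (s : ((UnitaryGroup.cmDatum L 2 (Matrix.of fun i j : Fin 2 => if i.val + j.val + 1 = 2 then (1 : L) else 0)).Local v × (UnitaryGroup.cmDatum L 1 (Matrix.of fun i j : Fin 1 => if i.val + j.val + 1 = 1 then (1 : L) else 0)).Local v)) →
      ∑ i : Fin (n MH), (dG ((eT MH i s : ↥(Subgroup.centralizer ({γc MH i} : Set (Gqs L v)))) : Gqs L v) : ℂ) *
          (finTau L v s.1 μ * (dH s.1 : ℂ) * ((finKappaAt L v (qsForm L) s.1 ((eT MH i s : ↥(Subgroup.centralizer ({γc MH i} : Set (Gqs L v)))) : Gqs L v) : ℤ) : ℂ) * α s.1) *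
          classOrbitalIntegral mQv f (ConjClasses.mk ((eT MH i s : ↥(Subgroup.centralizer ({γc MH i} : Set (Gqs L v)))) : Gqs L v)) =
        ((dH s.1 : ℂ)) ^ 2 * α s.1 * stableOrbitalIntegralRel (IsLocalStablyConjH L v) mHv fH s.1)
    -- the GIVEN `G`-side torus integrand on `M`
    (hIGM : Integrable (fun t : ↥M => ((dG (t : Gqs L v) : ℂ)) ^ 2 *
      (if IsRegularElt (((t : Gqs L v)).val : GL (Fin 3) (UnitaryGroup.LocalRing L v)) then ((dG (t : Gqs L v) : ℂ))⁻¹ * ∑ᶠ q : Quot (IsLocalStablyConjH L v), (if IsLocalGRegular L v q.out ∧ IsLocalNormPair L (qsForm L) v q.out (t : Gqs L v) then finTau L v q.out μ * (dH q.out : ℂ) * ((finKappaAt L v (qsForm L) q.out (t : Gqs L v) : ℤ) : ℂ) * α q.out else 0) else 0) *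
      classOrbitalIntegral mQv f (ConjClasses.mk (t : Gqs L v))) μM) :
    (((M.subgroupOf (Subgroup.normalizer (M : Set (Gqs L v)))).index : ℂ))⁻¹ * ∫ t : ↥M, ((dG (t : Gqs L v) : ℂ)) ^ 2 *
      (if IsRegularElt (((t : Gqs L v)).val : GL (Fin 3) (UnitaryGroup.LocalRing L v)) then ((dG (t : Gqs L v) : ℂ))⁻¹ * ∑ᶠ q : Quot (IsLocalStablyConjH L v), (if IsLocalGRegular L v q.out ∧ IsLocalNormPair L (qsForm L) v q.out (t : Gqs L v) then finTau L v q.out μ * (dH q.out : ℂ) * ((finKappaAt L v (qsForm L) q.out (t : Gqs L v) : ℤ) : ℂ) * α q.out else 0) else 0) *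
      classOrbitalIntegral mQv f (ConjClasses.mk (t : Gqs L v)) ∂μM =
      ((((MH.subgroupOf (Subgroup.normalizer (MH : Set ((UnitaryGroup.cmDatum L 2 (Matrix.of fun i j : Fin 2 => if i.val + j.val + 1 = 2 then (1 : L) else 0)).Local v × (UnitaryGroup.cmDatum L 1 (Matrix.of fun i j : Fin 1 => if i.val + j.val + 1 = 1 then (1 : L) else 0)).Local v)))).index : ℂ))⁻¹ * ((m MH : ℂ))⁻¹) *
        ∫ s : ↥MH, ((dH (s : ((UnitaryGroup.cmDatum L 2 (Matrix.of fun i j : Fin 2 => if i.val + j.val + 1 = 2 then (1 : L) else 0)).Local v × (UnitaryGroup.cmDatum L 1 (Matrix.of fun i j : Fin 1 => if i.val + j.val + 1 = 1 then (1 : L) else 0)).Local v)) : ℂ)) ^ 2 * α (s : ((UnitaryGroup.cmDatum L 2 (Matrix.of fun i j : Fin 2 => if i.val + j.val + 1 = 2 then (1 : L) else 0)).Local v × (UnitaryGroup.cmDatum L 1 (Matrix.of fun i j : Fin 1 => if i.val + j.val + 1 = 1 then (1 : L) else 0)).Local v)) * stableOrbitalIntegralRel (IsLocalStablyConjH L v)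 mHv fH (s : ((UnitaryGroup.cmDatum L 2 (Matrix.of fun i j : Fin 2 => if i.val + j.val + 1 = 2 then (1 : L) else 0)).Local v × (UnitaryGroup.cmDatum L 1 (Matrix.of fun i j : Fin 1 => if i.val + j.val + 1 = 1 then (1 : L) else 0)).Local v)) ∂tT := by
  -- ### the up-function and the torus integrand, named
  set up : Gqs L v → ℂ := fun x => (if IsRegularElt ((x).val : GL (Fin 3) (UnitaryGroup.LocalRing L v)) then ((dG x : ℂ))⁻¹ * ∑ᶠ q : Quot (IsLocalStablyConjH L v), (if IsLocalGRegular L v q.out ∧ IsLocalNormPair L (qsForm L) v q.out x then finTau L v q.out μ * (dH q.out : ℂ) * ((finKappaAt L v (qsForm L) q.out x : ℤ) : ℂ) * α q.out else 0) else 0) with hup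
  set Ψ : Gqs L v → ℂ := fun x => ((dG x : ℂ)) ^ 2 * up x * classOrbitalIntegral mQv f (ConjClasses.mk x) with hΨ
  set F : ((UnitaryGroup.cmDatum L 2 (Matrix.of fun i j : Fin 2 => if i.val + j.val + 1 = 2 then (1 : L) else 0)).Local v × (UnitaryGroup.cmDatum L 1 (Matrix.of fun i j : Fin 1 => if i.val + j.val + 1 = 1 then (1 : L) else 0)).Local v) → ℂ := fun a => ((dH a : ℂ)) ^ 2 * α a * stableOrbitalIntegralRel (IsLocalStablyConjH L v) mHv fH a with hFdef
  show (((M.subgroupOf (Subgroup.normalizer (M : Set (Gqs L v)))).index : ℂ))⁻¹ * ∫ t : ↥M, Ψ (t : Gqs L v) ∂μM =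
    ((((MH.subgroupOf (Subgroup.normalizer (MH : Set ((UnitaryGroup.cmDatum L 2 (Matrix.of fun i j : Fin 2 => if i.val + j.val + 1 = 2 then (1 : L) else 0)).Local v × (UnitaryGroup.cmDatum L 1 (Matrix.of fun i j : Fin 1 => if i.val + j.val + 1 = 1 then (1 : L) else 0)).Local v)))).index : ℂ))⁻¹ * ((m MH : ℂ))⁻¹) * ∫ s : ↥MH, F (s : ((UnitaryGroup.cmDatum L 2 (Matrix.of fun i j : Fin 2 => if i.val + j.val + 1 = 2 then (1 : L) else 0)).Local v × (UnitaryGroup.cmDatum L 1 (Matrix.of fun i j : Fin 1 => if i.val + j.val + 1 = 1 then (1 : L) else 0)).Local v)) ∂tT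
  have hαst' : ∀ a b, IsLocalGRegular L v a → IsLocalStablyConjH L v a b → α b = α a := fun a b ha h => hαst.2 a ha b h
  -- ### (i) `up`, `Ψ` are class functions; `Ψ` vanishes off the regular set
  have hupc : ∀ x c : Gqs L v, up (c * x * c⁻¹) = up x := by
    intro x c
    have hreg : IsRegularElt ((c * x * c⁻¹).val : GL (Fin 3) (UnitaryGroup.LocalRing L v)) ↔ IsRegularElt ((x).val : GL (Fin 3) (UnitaryGroup.LocalRing L v)) := isRegularElt_conj_val_iff L v c x
    show (if IsRegularElt (((c * x * c⁻¹)).val : GL (Fin 3) (UnitaryGroup.LocalRing L v)) then ((dG (c * x * c⁻¹) : ℂ))⁻¹ * ∑ᶠ q : Quot (IsLocalStablyConjH L v), (if IsLocalGRegular L v q.out ∧ IsLocalNormPair L (qsForm L) v q.out (c * x * c⁻¹) then finTau L v q.out μ * (dH q.out : ℂ) * ((finKappaAt L v (qsForm L) q.out (c * x * c⁻¹) : ℤ) : ℂ) * α q.out else 0) else 0) = (if IsRegularElt ((x).val : GL (Fin 3) (UnitaryGroup.LocalRing L v)) then ((dG x : ℂ))⁻¹ * ∑ᶠ q : Quot (IsLocalStablyConjH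 L v), (if IsLocalGRegular L v q.out ∧ IsLocalNormPair L (qsForm L) v q.out x then finTau L v q.out μ * (dH q.out : ℂ) * ((finKappaAt L v (qsForm L) q.out x : ℤ) : ℂ) * α q.out else 0) else 0)
    by_cases hx : IsRegularElt ((x).val : GL (Fin 3) (UnitaryGroup.LocalRing L v))
    · rw [if_pos (hreg.2 hx), if_pos hx, hdG]
      congr 1
      refine finsum_congr fun q => ?_
      by_cases hR : IsLocalNormPair L (qsForm L) v q.out x
      · have hR' : IsLocalNormPair L (qsForm L) v q.out (c * x * c⁻¹) := isLocalNormPair_of_isConj_right L v q.out (isConj_iff.2 ⟨c, rfl⟩) hR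
        simp only [hR, hR', and_true, finKappaAt_conj_right L v (qsForm L) q.out x c hR]
      · have hR' : ¬ IsLocalNormPair L (qsForm L) v q.out (c * x * c⁻¹) := fun h =>
          hR (isLocalNormPair_of_isConj_right L v q.out (isConj_iff.2 ⟨c, rfl⟩ : IsConj x (c * x * c⁻¹)).symm h)
        simp only [hR, hR', and_false, if_false]
    · rw [if_neg (fun h => hx (hreg.1 h)), if_neg hx]
  have hΨc : ∀ x z : Gqs L v, IsConj x z → Ψ x = Ψ z := by
    intro x z hxz
    have hcl : ConjClasses.mk x = ConjClasses.mk z := ConjClasses.mk_eq_mk_iff_isConj.2 hxz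
    obtain ⟨c, rfl⟩ := isConj_iff.1 hxz
    show ((dG x : ℂ)) ^ 2 * up x * classOrbitalIntegral mQv f (ConjClasses.mk x) = ((dG (c * x * c⁻¹) : ℂ)) ^ 2 * up (c * x * c⁻¹) * classOrbitalIntegral mQv f (ConjClasses.mk (c * x * c⁻¹))
    rw [hupc, hdG, hcl]
  have hΨ0 : ∀ x : Gqs L v, ¬ IsRegularElt (x.val : GL (Fin 3) (UnitaryGroup.LocalRing L v)) → Ψ x = 0 := by
    intro x hx
    have h0 : up x = 0 := by
      show (if IsRegularElt ((x).val : GL (Fin 3) (UnitaryGroup.LocalRing L v)) then ((dG x : ℂ))⁻¹ * ∑ᶠ q : Quot (IsLocalStablyConjH L v), (if IsLocalGRegular L v q.out ∧ IsLocalNormPair L (qsForm L) v q.out x then finTau L v q.out μ * (dH q.out : ℂ) * ((finKappaAt L v (qsForm L) q.out x : ℤ) : ℂ) * α q.out else 0) else 0) = 0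
      rw [if_neg hx]
    show ((dG x : ℂ)) ^ 2 * up x * classOrbitalIntegral mQv f (ConjClasses.mk x) = 0
    rw [h0, mul_zero, zero_mul]
  have hΨ0' : ∀ x : Gqs L v, (¬ ∃ q : ((UnitaryGroup.cmDatum L 2 (Matrix.of fun i j : Fin 2 => if i.val + j.val + 1 = 2 then (1 : L) else 0)).Local v × (UnitaryGroup.cmDatum L 1 (Matrix.of fun i j : Fin 1 => if i.val + j.val + 1 = 1 then (1 : L) else 0)).Local v), IsLocalGRegular L v q ∧ IsLocalNormPair L (qsForm L) v q x) → Ψ x = 0 := by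
    intro x hx
    have h0 : up x = 0 := by
      have h00 : (∑ᶠ q : Quot (IsLocalStablyConjH L v), (if IsLocalGRegular L v q.out ∧ IsLocalNormPair L (qsForm L) v q.out x then finTau L v q.out μ * (dH q.out : ℂ) * ((finKappaAt L v (qsForm L) q.out x : ℤ) : ℂ) * α q.out else 0)) = 0 :=
        finsum_eq_zero_of_forall_eq_zero fun q => if_neg fun hq => hx ⟨q.out, hq⟩
      show (if IsRegularElt ((x).val : GL (Fin 3) (UnitaryGroup.LocalRing L v)) then ((dG x : ℂ))⁻¹ * ∑ᶠ q : Quot (IsLocalStablyConjH L v), (if IsLocalGRegular L v q.out ∧ IsLocalNormPair L (qsForm L) v q.out x then finTau L v q.out μ * (dH q.out : ℂ) * ((finKappaAt L v (qsForm L) q.out x : ℤ) : ℂ) * α q.out else 0) else 0) = 0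
      rw [h00, mul_zero, ite_self]
    show ((dG x : ℂ)) ^ 2 * up x * classOrbitalIntegral mQv f (ConjClasses.mk x) = 0
    rw [h0, mul_zero, zero_mul]
  -- ### (ii) LANDING: the embeddings of `MH` land in `M`, those of the compact members land in compact members `≠ M`
  have hlandM : ∀ i : Fin (n MH), ∃ y : Gqs L v, ∀ g : Gqs L v, g ∈ Subgroup.centralizer ({γc MH i} : Set (Gqs L v)) ↔ y⁻¹ * g * y ∈ M := by
    intro i
    obtain ⟨T₀, hT₀, y, hy⟩ := hcovC (γc MH i) (hγc MH hMH i)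
    by_cases hTM : T₀ = M
    · subst hTM; exact ⟨y, hy⟩
    · exfalso
      have hZc : IsCompact ((Subgroup.centralizer ({γc MH i} : Set (Gqs L v)) : Subgroup (Gqs L v)) : Set (Gqs L v)) :=
        isCompact_of_forall_mem_iff_conj y hy (hcptC T₀ hT₀ hTM)
      haveI : CompactSpace ↥(Subgroup.centralizer ({γc MH i} : Set (Gqs L v))) := isCompact_iff_compactSpace.1 hZc
      haveI : CompactSpace ↥MH := (eT MH i).symm.toHomeomorph.compactSpace
      exact hMHnc (isCompact_iff_compactSpace.2 inferInstance)
  have hlandC : ∀ T ∈ SH, T ≠ MH → ∀ i : Fin (n T), ∃ T₀ ∈ C, T₀ ≠ M ∧ ∃ y : Gqs L v, ∀ g : Gqs L v, g ∈ Subgroup.centralizer ({γc T i} : Set (Gqs L v)) ↔ y⁻¹ * g * y ∈ T₀ := by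
    intro T hT hTne i
    obtain ⟨T₀, hT₀, y, hy⟩ := hcovC (γc T i) (hγc T hT i)
    refine ⟨T₀, hT₀, fun hTM => hMnc ?_, y, hy⟩
    subst hTM
    -- `Z_G(γc T i)` is compact (≅ the compact `T`) and `T₀ = y⁻¹ Z y`
    haveI : CompactSpace ↥T := isCompact_iff_compactSpace.1 (hcpt T hT hTne)
    haveI : CompactSpace ↥(Subgroup.centralizer ({γc T i} : Set (Gqs L v))) := (eT T i).toHomeomorph.compactSpace
    have hZc : IsCompact ((Subgroup.centralizer ({γc T i} : Set (Gqs L v)) : Subgroup (Gqs L v)) : Set (Gqs L v)) := isCompact_iff_compactSpace.2 inferInstance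
    have hy' : ∀ g : Gqs L v, g ∈ T₀ ↔ (y⁻¹)⁻¹ * g * y⁻¹ ∈ Subgroup.centralizer ({γc T i} : Set (Gqs L v)) := fun g => by
      rw [hy, inv_inv]; constructor <;> intro h <;> simpa [mul_assoc] using h
    exact isCompact_of_forall_mem_iff_conj y⁻¹ hy' hZc
  -- ### (iii) DENSITY at a matched regular `x ∈ M`: only the split member counts, with total weight one
  have hM_Z : ∀ x : ↥M, IsRegularElt (((x : Gqs L v)).val : GL (Fin 3) (UnitaryGroup.LocalRing L v)) →
      Subgroup.centralizer ({(x : Gqs L v)} : Set (Gqs L v)) = M := fun x hx => centralizer_eq_cartan_of_isRegularElt hm₀ hM x hx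
  -- the fibres of the compact members over a regular `x ∈ M` are empty
  have hfib0 : ∀ T ∈ SH, T ≠ MH → ∀ (i : Fin (n T)) (x : ↥M), IsRegularElt (((x : Gqs L v)).val : GL (Fin 3) (UnitaryGroup.LocalRing L v)) →
      {s : ↥T | IsConj ((eT T i s : ↥(Subgroup.centralizer ({γc T i} : Set (Gqs L v)))) : Gqs L v) (x : Gqs L v)}.ncard = 0 := by
    intro T hT hTne i x hx
    obtain ⟨T₀, hT₀, hT₀M, y, hy⟩ := hlandC T hT hTne i
    exact ncard_setOf_isConj_apply_eq_zero_of_ne L v T (hγc T hT i) (eT T i) y hy hm₀ hM (hncC T₀ hT₀ M hMC hT₀M) x hx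
  -- the fibres of the split member over a regular `x ∈ M` are torsors
  have hfibM : ∀ (i : Fin (n MH)) (x : ↥M), IsRegularElt (((x : Gqs L v)).val : GL (Fin 3) (UnitaryGroup.LocalRing L v)) →
      {s : ↥MH | IsConj ((eT MH i s : ↥(Subgroup.centralizer ({γc MH i} : Set (Gqs L v)))) : Gqs L v) (x : Gqs L v)}.ncard =
        (M.subgroupOf (Subgroup.normalizer (M : Set (Gqs L v)))).index := by
    intro i x hx
    obtain ⟨y, hy⟩ := hlandM i
    exact ncard_setOf_isConj_apply_eq_index L v MH (eT MH i) y hy hm₀ hM x hx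
  have hdens : ∀ x : ↥M, IsRegularElt (((x : Gqs L v)).val : GL (Fin 3) (UnitaryGroup.LocalRing L v)) →
      (∃ q : ((UnitaryGroup.cmDatum L 2 (Matrix.of fun i j : Fin 2 => if i.val + j.val + 1 = 2 then (1 : L) else 0)).Local v × (UnitaryGroup.cmDatum L 1 (Matrix.of fun i j : Fin 1 => if i.val + j.val + 1 = 1 then (1 : L) else 0)).Local v), IsLocalGRegular L v q ∧ IsLocalNormPair L (qsForm L) v q (x : Gqs L v)) →
      ((((MH.subgroupOf (Subgroup.normalizer (MH : Set ((UnitaryGroup.cmDatum L 2 (Matrix.of fun i j : Fin 2 => if i.val + j.val + 1 = 2 then (1 : L) else 0)).Local v × (UnitaryGroup.cmDatum L 1 (Matrix.of fun i j : Fin 1 => if i.val + j.val + 1 = 1 then (1 : L) else 0)).Local v)))).index : ℂ))⁻¹ * ((m MH : ℂ))⁻¹) *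
        ∑ i : Fin (n MH), (({s : ↥MH | IsConj ((eT MH i s : ↥(Subgroup.centralizer ({γc MH i} : Set (Gqs L v)))) : Gqs L v) (x : Gqs L v)}.ncard : ℂ)) = 1 := by
    intro x hx hmatch
    obtain ⟨q₀, hq₀, hq₀x⟩ := hmatch
    -- a fibre point INSIDE the split member: `q₀ ∼ s₀ ∈ T ∈ SH`, and `T = MH` (the embeddings of a compact member cannot meet the hyperbolic `x`)
    obtain ⟨T, hT, s₀, hs₀T, hq₀s₀⟩ := hcomplete q₀ hq₀
    have hs₀ : IsLocalGRegular L v s₀ := isLocalGRegular_of_isLocalStablyConjH L v hq₀ (isStablyConjH_of_isConj hq₀s₀)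
    have hs₀x : IsLocalNormPair L (qsForm L) v s₀ (x : Gqs L v) := (isLocalNormPair_iff_of_isLocalStablyConjH L v (qsForm L) (isStablyConjH_of_isConj hq₀s₀) _).2 hq₀x
    have hTMH : T = MH := by
      by_contra hTne
      obtain ⟨i, hi, -⟩ := hψuniq T hT s₀ hs₀T hs₀ (x : Gqs L v) hs₀x
      have hmem : s₀ ∈ fib (x : Gqs L v) T i := (hfib (x : Gqs L v) T hT i s₀).2 ⟨hs₀T, hs₀, hi⟩
      have h0 := hfib0 T hT hTne i x hx
      rw [F0P3cStCharTSEllInnerGRegroup.ncard_eq_card_fib L v SH n γc eT heT ψ hψ fib hfib hT i (x : Gqs L v) hx] at h0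
      exact absurd h0 (Finset.card_ne_zero.2 ⟨s₀, hmem⟩)
    subst hTMH
    -- ★ (E0-count) on the all-shapes system at the singleton transversal `{s₀}`
    have hreg' : ∀ a b : ((UnitaryGroup.cmDatum L 2 (Matrix.of fun i j : Fin 2 => if i.val + j.val + 1 = 2 then (1 : L) else 0)).Local v × (UnitaryGroup.cmDatum L 1 (Matrix.of fun i j : Fin 1 => if i.val + j.val + 1 = 1 then (1 : L) else 0)).Local v), IsLocalStablyConjH L v a b → IsLocalGRegular L v a → IsLocalGRegular L v b :=
      fun a b h ha => isLocalGRegular_of_isLocalStablyConjH L v ha h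
    have hRst : ∀ (a b : ((UnitaryGroup.cmDatum L 2 (Matrix.of fun i j : Fin 2 => if i.val + j.val + 1 = 2 then (1 : L) else 0)).Local v × (UnitaryGroup.cmDatum L 1 (Matrix.of fun i j : Fin 1 => if i.val + j.val + 1 = 1 then (1 : L) else 0)).Local v)) (g' : Gqs L v), IsLocalStablyConjH L v a b → IsLocalNormPair L (qsForm L) v a g' → IsLocalNormPair L (qsForm L) v b g' :=
      fun a b g' h hR => (isLocalNormPair_iff_of_isLocalStablyConjH L v (qsForm L) h g').2 hR
    have key := Literature.GroupTheory.StableFibre.weighted_fibre_card_eq_one (G := Gqs L v)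
      (IsLocalStablyConjH L v) (fun a => IsStablyConjH.refl _ _ _ a) (fun a b h => h.symm) (fun a b c h h' => h.trans h')
      (fun a b h => isStablyConjH_of_isConj h)
      (fun a => IsLocalGRegular L v a) hreg'
      (fun a g' => IsLocalNormPair L (qsForm L) v a g') hRst (fun a g₁ g₂ hg hR => isLocalNormPair_of_isConj_right L v a hg hR)
      SH (fun T => (T.subgroupOf (Subgroup.normalizer (T : Set ((UnitaryGroup.cmDatum L 2 (Matrix.of fun i j : Fin 2 => if i.val + j.val + 1 = 2 then (1 : L) else 0)).Local v × (UnitaryGroup.cmDatum L 1 (Matrix.of fun i j : Fin 1 => if i.val + j.val + 1 = 1 then (1 : L) else 0)).Local v)))).index) m n ψ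
      hcomplete hirred
      (fun T hT s hs hsreg => by
        obtain ⟨γ₀, hγ₀, hTeq⟩ := hZ T hT
        exact exists_finset_mem_isConj_card_eq_index_centralizerH L v hns hγ₀ hTeq hs hsreg)
      hclasses hψR hψuniq
      (x : Gqs L v) {s₀} (fun q hq => by rw [Finset.mem_singleton] at hq; subst hq; exact ⟨hs₀, hs₀x⟩)
      (fun q hq q' hq' _ => by rw [Finset.mem_singleton] at hq hq'; rw [hq, hq'])
      (fun a ha hR => ⟨s₀, Finset.mem_singleton_self _, hone s₀ hs₀T hs₀ a ha (x : Gqs L v) hs₀x hR⟩) ⟨s₀, Finset.mem_singleton_self _⟩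
      (fib (x : Gqs L v)) (fun T hT i a => hfib (x : Gqs L v) T hT i a)
      (fun _ => 1) (fun T hT i hne => by rw [Finset.card_singleton])
    -- read the (N5) fibre count as the (E0a) count, and drop the compact members
    have herase : ∑ T' ∈ SH.erase T, ((((T'.subgroupOf (Subgroup.normalizer (T' : Set ((UnitaryGroup.cmDatum L 2 (Matrix.of fun i j : Fin 2 => if i.val + j.val + 1 = 2 then (1 : L) else 0)).Local v × (UnitaryGroup.cmDatum L 1 (Matrix.of fun i j : Fin 1 => if i.val + j.val + 1 = 1 then (1 : L) else 0)).Local v)))).index : ℂ))⁻¹ * ((m T' : ℂ))⁻¹ * (((1 : ℕ) : ℂ))⁻¹) *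
        ∑ i : Fin (n T'), (((fib (x : Gqs L v) T' i).card : ℂ)) = 0 := by
      refine Finset.sum_eq_zero fun T' hT' => ?_
      obtain ⟨hTne, hT''⟩ := Finset.mem_erase.1 hT'
      rw [Finset.sum_eq_zero (fun i _ => ?_), mul_zero]
      rw [← F0P3cStCharTSEllInnerGRegroup.ncard_eq_card_fib L v SH n γc eT heT ψ hψ fib hfib hT'' i (x : Gqs L v) hx, hfib0 T' hT'' hTne i x hx, Nat.cast_zero]
    rw [← key, ← Finset.add_sum_erase SH _ hMH, herase, add_zero]
    simp only [Nat.cast_one, inv_one, mul_one]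
    congr 1
    refine Finset.sum_congr rfl fun i _ => ?_
    rw [F0P3cStCharTSEllInnerGRegroup.ncard_eq_card_fib L v SH n γc eT heT ψ hψ fib hfib hMH i (x : Gqs L v) hx]
  -- ### (iv) the pointwise density on `M`, split member only
  have hpt : ∀ x : ↥M, Ψ (x : Gqs L v) = ((((MH.subgroupOf (Subgroup.normalizer (MH : Set ((UnitaryGroup.cmDatum L 2 (Matrix.of fun i j : Fin 2 => if i.val + j.val + 1 = 2 then (1 : L) else 0)).Local v × (UnitaryGroup.cmDatum L 1 (Matrix.of fun i j : Fin 1 => if i.val + j.val + 1 = 1 then (1 : L) else 0)).Local v)))).index : ℂ))⁻¹ * ((m MH : ℂ))⁻¹) *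
      ∑ i : Fin (n MH), ((({s : ↥MH | IsConj ((eT MH i s : ↥(Subgroup.centralizer ({γc MH i} : Set (Gqs L v)))) : Gqs L v) (x : Gqs L v)}.ncard : ℂ)) * Ψ (x : Gqs L v)) := by
    intro x
    by_cases hx : IsRegularElt (((x : Gqs L v)).val : GL (Fin 3) (UnitaryGroup.LocalRing L v))
    · by_cases hmatch : ∃ q : ((UnitaryGroup.cmDatum L 2 (Matrix.of fun i j : Fin 2 => if i.val + j.val + 1 = 2 then (1 : L) else 0)).Local v × (UnitaryGroup.cmDatum L 1 (Matrix.of fun i j : Fin 1 => if i.val + j.val + 1 = 1 then (1 : L) else 0)).Local v), IsLocalGRegular L v q ∧ IsLocalNormPair L (qsForm L) v q (x : Gqs L v)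
      · calc Ψ (x : Gqs L v) = (((((MH.subgroupOf (Subgroup.normalizer (MH : Set ((UnitaryGroup.cmDatum L 2 (Matrix.of fun i j : Fin 2 => if i.val + j.val + 1 = 2 then (1 : L) else 0)).Local v × (UnitaryGroup.cmDatum L 1 (Matrix.of fun i j : Fin 1 => if i.val + j.val + 1 = 1 then (1 : L) else 0)).Local v)))).index : ℂ))⁻¹ * ((m MH : ℂ))⁻¹) *
              ∑ i : Fin (n MH), (({s : ↥MH | IsConj ((eT MH i s : ↥(Subgroup.centralizer ({γc MH i} : Set (Gqs L v)))) : Gqs L v) (x : Gqs L v)}.ncard : ℂ))) * Ψ (x : Gqs L v) := by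
                rw [hdens x hx hmatch, one_mul]
          _ = _ := by rw [mul_assoc, Finset.sum_mul]
      · rw [hΨ0' _ hmatch]; simp only [mul_zero, Finset.sum_const_zero]
    · rw [hΨ0 _ hx]; simp only [mul_zero, Finset.sum_const_zero]
  -- ### (v) integrate over `M`: per embedding, the count is the torsor `[N_G(M):M]` and ★ (E0a) transports to `MH`
  have hidxM : (M.subgroupOf (Subgroup.normalizer (M : Set (Gqs L v)))).index ≠ 0 := index_cartan_subgroupOf_normalizer_ne_zero hm₀ hM hns
  have hpiece : ∀ i : Fin (n MH), Integrable (fun x : ↥M => ((({s : ↥MH | IsConj ((eT MH i s : ↥(Subgroup.centralizer ({γc MH i} : Set (Gqs L v)))) : Gqs L v) (x : Gqs L v)}.ncard : ℂ)) * Ψ (x : Gqs L v))) μM ∧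
      (((M.subgroupOf (Subgroup.normalizer (M : Set (Gqs L v)))).index : ℂ))⁻¹ *
        ∫ x : ↥M, ((({s : ↥MH | IsConj ((eT MH i s : ↥(Subgroup.centralizer ({γc MH i} : Set (Gqs L v)))) : Gqs L v) (x : Gqs L v)}.ncard : ℂ)) * Ψ (x : Gqs L v)) ∂μM =
        ∫ s : ↥MH, Ψ ((eT MH i s : ↥(Subgroup.centralizer ({γc MH i} : Set (Gqs L v)))) : Gqs L v) ∂tT := by
    intro i
    obtain ⟨y, hy⟩ := hlandM i
    have hptM : ∀ x : ↥M, ((({s : ↥MH | IsConj ((eT MH i s : ↥(Subgroup.centralizer ({γc MH i} : Set (Gqs L v)))) : Gqs L v) (x : Gqs L v)}.ncard : ℂ)) * Ψ (x : Gqs L v)) =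
        (((M.subgroupOf (Subgroup.normalizer (M : Set (Gqs L v)))).index : ℂ)) * Ψ (x : Gqs L v) := by
      intro x
      by_cases hx : IsRegularElt (((x : Gqs L v)).val : GL (Fin 3) (UnitaryGroup.LocalRing L v))
      · rw [ncard_setOf_isConj_apply_eq_index L v MH (eT MH i) y hy hm₀ hM x hx]
      · rw [hΨ0 _ hx, mul_zero, mul_zero]
    refine ⟨(hIGM.const_mul (((M.subgroupOf (Subgroup.normalizer (M : Set (Gqs L v)))).index : ℂ))).congr (ae_of_all _ fun x => (hptM x).symm), ?_⟩
    rw [integral_congr_ae (ae_of_all _ hptM), integral_const_mul, ← mul_assoc, inv_mul_cancel₀ (Nat.cast_ne_zero.2 hidxM), one_mul]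
    exact integral_eq_integral_comp_of_conj_into L v MH tT htT (eT MH i) y hy hM μM hμM Ψ hΨc
  -- integrability of the transported integrand on `MH` (whole-measure transport of `hIGM`, ★ (E0) companion's argument)
  have hint : ∀ i : Fin (n MH), Integrable (fun s : ↥MH => Ψ ((eT MH i s : ↥(Subgroup.centralizer ({γc MH i} : Set (Gqs L v)))) : Gqs L v)) tT := by
    intro i
    obtain ⟨y, hy⟩ := hlandM i
    obtain ⟨c, hc⟩ := exists_conj_continuousMulEquiv L v (Z := Subgroup.centralizer ({γc MH i} : Set (Gqs L v))) y hy
    have hmap : Measure.map ((eT MH i).trans c) tT = μM :=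
      map_continuousMulEquiv_eq_of_apply_compactCore_eq_one L v MH hM ((eT MH i).trans c) tT htT μM hμM
    have h1 : Integrable (fun x : ↥M => Ψ (x : Gqs L v)) (Measure.map ((eT MH i).trans c) tT) := by rw [hmap]; exact hIGM
    have h2 := (integrable_map_equiv ((eT MH i).trans c).toHomeomorph.toMeasurableEquiv (fun x : ↥M => Ψ (x : Gqs L v))).1 h1
    have heq : (fun x : ↥M => Ψ (x : Gqs L v)) ∘ (((eT MH i).trans c).toHomeomorph.toMeasurableEquiv) =
        fun s : ↥MH => Ψ ((eT MH i s : ↥(Subgroup.centralizer ({γc MH i} : Set (Gqs L v)))) : Gqs L v) := by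
      funext s
      show Ψ ((((eT MH i).trans c) s : ↥M) : Gqs L v) = Ψ ((eT MH i s : ↥(Subgroup.centralizer ({γc MH i} : Set (Gqs L v)))) : Gqs L v)
      rw [ContinuousMulEquiv.trans_apply, hc]
      exact hΨc _ _ (isConj_iff.2 ⟨y, by group⟩)
    rw [heq] at h2
    exact h2
  -- ### (vi) the pointwise identity at a `G`-regular `s ∈ MH`: `Σ_i Ψ(e_i s) = F(s)` (UP-EVAL on the singleton transversal, then (P2))
  have hptH : ∀ s : ↥MH, IsLocalGRegular L v (s : ((UnitaryGroup.cmDatum L 2 (Matrix.of fun i j : Fin 2 => if i.val + j.val + 1 = 2 then (1 : L) else 0)).Local v × (UnitaryGroup.cmDatum L 1 (Matrix.of fun i j : Fin 1 => if i.val + j.val + 1 = 1 then (1 : L) else 0)).Local v)) →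
      ∑ i : Fin (n MH), Ψ ((eT MH i s : ↥(Subgroup.centralizer ({γc MH i} : Set (Gqs L v)))) : Gqs L v) = F (s : ((UnitaryGroup.cmDatum L 2 (Matrix.of fun i j : Fin 2 => if i.val + j.val + 1 = 2 then (1 : L) else 0)).Local v × (UnitaryGroup.cmDatum L 1 (Matrix.of fun i j : Fin 1 => if i.val + j.val + 1 = 1 then (1 : L) else 0)).Local v)) := by
    intro s hs
    have hxreg : ∀ i : Fin (n MH), IsRegularElt ((((eT MH i s : ↥(Subgroup.centralizer ({γc MH i} : Set (Gqs L v)))) : Gqs L v)).val : GL (Fin 3) (UnitaryGroup.LocalRing L v)) := fun i =>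
      (isLocalGRegular_iff_isRegularElt_of_isLocalNormPair L v (heT MH hMH i s)).1 hs
    have hupi : ∀ i : Fin (n MH), up ((eT MH i s : ↥(Subgroup.centralizer ({γc MH i} : Set (Gqs L v)))) : Gqs L v) =
        ((dG ((eT MH i s : ↥(Subgroup.centralizer ({γc MH i} : Set (Gqs L v)))) : Gqs L v) : ℂ))⁻¹ *
          (finTau L v s.1 μ * (dH s.1 : ℂ) * ((finKappaAt L v (qsForm L) s.1 ((eT MH i s : ↥(Subgroup.centralizer ({γc MH i} : Set (Gqs L v)))) : Gqs L v) : ℤ) : ℂ) * α s.1) := by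
      intro i
      show (if IsRegularElt ((((eT MH i s : ↥(Subgroup.centralizer ({γc MH i} : Set (Gqs L v)))) : Gqs L v)).val : GL (Fin 3) (UnitaryGroup.LocalRing L v)) then ((dG ((eT MH i s : ↥(Subgroup.centralizer ({γc MH i} : Set (Gqs L v)))) : Gqs L v) : ℂ))⁻¹ * ∑ᶠ q : Quot (IsLocalStablyConjH L v), (if IsLocalGRegular L v q.out ∧ IsLocalNormPair L (qsForm L) v q.out ((eT MH i s : ↥(Subgroup.centralizer ({γc MH i} : Set (Gqs L v)))) : Gqs L v) then finTau L v q.out μ * (dH q.out : ℂ) * ((finKappaAt L v (qsForm L) q.out ((eT MH i s : ↥(Subgroup.centralizer ({γc MH i} : Set (Gqs L v)))) : Gqs L v) : ℤ) : ℂ) * α q.out else 0) else 0) = _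
      rw [if_pos (hxreg i)]
      congr 1
      rw [finsum_upSummand_eq_sum L v μ ((eT MH i s : ↥(Subgroup.centralizer ({γc MH i} : Set (Gqs L v)))) : Gqs L v) dH hDHst α hαst' {s.1}
        (fun t ht => by rw [Finset.mem_singleton] at ht; subst ht; exact ⟨hs, heT MH hMH i s⟩)
        (fun t ht t' ht' hne => by rw [Finset.mem_singleton] at ht ht'; exact absurd (ht.trans ht'.symm) hne)
        (fun a ha hR => ⟨s.1, Finset.mem_singleton_self _, hone s.1 s.2 hs a ha _ (heT MH hMH i s) hR⟩),
        Finset.sum_singleton]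
    calc ∑ i : Fin (n MH), Ψ ((eT MH i s : ↥(Subgroup.centralizer ({γc MH i} : Set (Gqs L v)))) : Gqs L v)
        = ∑ i : Fin (n MH), (dG ((eT MH i s : ↥(Subgroup.centralizer ({γc MH i} : Set (Gqs L v)))) : Gqs L v) : ℂ) *
            (finTau L v s.1 μ * (dH s.1 : ℂ) * ((finKappaAt L v (qsForm L) s.1 ((eT MH i s : ↥(Subgroup.centralizer ({γc MH i} : Set (Gqs L v)))) : Gqs L v) : ℤ) : ℂ) * α s.1) *
            classOrbitalIntegral mQv f (ConjClasses.mk ((eT MH i s : ↥(Subgroup.centralizer ({γc MH i} : Set (Gqs L v)))) : Gqs L v)) := by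
          refine Finset.sum_congr rfl fun i _ => ?_
          show ((dG ((eT MH i s : ↥(Subgroup.centralizer ({γc MH i} : Set (Gqs L v)))) : Gqs L v) : ℂ)) ^ 2 * up ((eT MH i s : ↥(Subgroup.centralizer ({γc MH i} : Set (Gqs L v)))) : Gqs L v) * classOrbitalIntegral mQv f (ConjClasses.mk ((eT MH i s : ↥(Subgroup.centralizer ({γc MH i} : Set (Gqs L v)))) : Gqs L v)) = _
          rw [hupi i, F0P3cStCharTSUpTrSlotTransport.sq_mul_inv_mul_mul]
      _ = F (s : ((UnitaryGroup.cmDatum L 2 (Matrix.of fun i j : Fin 2 => if i.val + j.val + 1 = 2 then (1 : L) else 0)).Local v × (UnitaryGroup.cmDatum L 1 (Matrix.of fun i j : Fin 1 => if i.val + j.val + 1 = 1 then (1 : L) else 0)).Local v)) := hP2 s hs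
  -- ### (vii) assemble
  have hae : ∀ᵐ s ∂tT, IsLocalGRegular L v ((s : ↥MH) : ((UnitaryGroup.cmDatum L 2 (Matrix.of fun i j : Fin 2 => if i.val + j.val + 1 = 2 then (1 : L) else 0)).Local v × (UnitaryGroup.cmDatum L 1 (Matrix.of fun i j : Fin 1 => if i.val + j.val + 1 = 1 then (1 : L) else 0)).Local v)) := by
    have h := (measure_eq_zero_iff_ae_notMem (μ := tT)).1 hsingMH
    filter_upwards [h] with s hs
    simpa using hs
  calc (((M.subgroupOf (Subgroup.normalizer (M : Set (Gqs L v)))).index : ℂ))⁻¹ * ∫ t : ↥M, Ψ (t : Gqs L v) ∂μM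
      = (((M.subgroupOf (Subgroup.normalizer (M : Set (Gqs L v)))).index : ℂ))⁻¹ * ∫ x : ↥M, ((((MH.subgroupOf (Subgroup.normalizer (MH : Set ((UnitaryGroup.cmDatum L 2 (Matrix.of fun i j : Fin 2 => if i.val + j.val + 1 = 2 then (1 : L) else 0)).Local v × (UnitaryGroup.cmDatum L 1 (Matrix.of fun i j : Fin 1 => if i.val + j.val + 1 = 1 then (1 : L) else 0)).Local v)))).index : ℂ))⁻¹ * ((m MH : ℂ))⁻¹) *
          ∑ i : Fin (n MH), ((({s : ↥MH | IsConj ((eT MH i s : ↥(Subgroup.centralizer ({γc MH i} : Set (Gqs L v)))) : Gqs L v) (x : Gqs L v)}.ncard : ℂ)) * Ψ (x : Gqs L v)) ∂μM := by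
        rw [integral_congr_ae (ae_of_all _ hpt)]
    _ = ((((MH.subgroupOf (Subgroup.normalizer (MH : Set ((UnitaryGroup.cmDatum L 2 (Matrix.of fun i j : Fin 2 => if i.val + j.val + 1 = 2 then (1 : L) else 0)).Local v × (UnitaryGroup.cmDatum L 1 (Matrix.of fun i j : Fin 1 => if i.val + j.val + 1 = 1 then (1 : L) else 0)).Local v)))).index : ℂ))⁻¹ * ((m MH : ℂ))⁻¹) *
          ∑ i : Fin (n MH), ((((M.subgroupOf (Subgroup.normalizer (M : Set (Gqs L v)))).index : ℂ))⁻¹ *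
            ∫ x : ↥M, ((({s : ↥MH | IsConj ((eT MH i s : ↥(Subgroup.centralizer ({γc MH i} : Set (Gqs L v)))) : Gqs L v) (x : Gqs L v)}.ncard : ℂ)) * Ψ (x : Gqs L v)) ∂μM) := by
        rw [integral_const_mul, integral_finsetSum _ (fun i _ => (hpiece i).1), Finset.mul_sum, Finset.mul_sum, Finset.mul_sum]
        refine Finset.sum_congr rfl fun i _ => ?_
        ring
    _ = ((((MH.subgroupOf (Subgroup.normalizer (MH : Set ((UnitaryGroup.cmDatum L 2 (Matrix.of fun i j : Fin 2 => if i.val + j.val + 1 = 2 then (1 : L) else 0)).Local v × (UnitaryGroup.cmDatum L 1 (Matrix.of fun i j : Fin 1 => if i.val + j.val + 1 = 1 then (1 : L) else 0)).Local v)))).index : ℂ))⁻¹ * ((m MH : ℂ))⁻¹) *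
          ∑ i : Fin (n MH), ∫ s : ↥MH, Ψ ((eT MH i s : ↥(Subgroup.centralizer ({γc MH i} : Set (Gqs L v)))) : Gqs L v) ∂tT := by
        rw [Finset.sum_congr rfl fun i _ => (hpiece i).2]
    _ = ((((MH.subgroupOf (Subgroup.normalizer (MH : Set ((UnitaryGroup.cmDatum L 2 (Matrix.of fun i j : Fin 2 => if i.val + j.val + 1 = 2 then (1 : L) else 0)).Local v × (UnitaryGroup.cmDatum L 1 (Matrix.of fun i j : Fin 1 => if i.val + j.val + 1 = 1 then (1 : L) else 0)).Local v)))).index : ℂ))⁻¹ * ((m MH : ℂ))⁻¹) * ∫ s : ↥MH, F (s : ((UnitaryGroup.cmDatum L 2 (Matrix.of fun i j : Fin 2 => if i.val + j.val + 1 = 2 then (1 : L) else 0)).Local v × (UnitaryGroup.cmDatum L 1 (Matrix.of fun i j : Fin 1 => if i.val + j.val + 1 = 1 then (1 : L) else 0)).Local v)) ∂tT := by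
        rw [← integral_finsetSum Finset.univ (fun i _ => hint i), integral_congr_ae (hae.mono fun s hs => hptH s hs)]

end CM

end Summit.HodgeConjecture.HodgeConjecture.Cruxes.H413.F0P3cStCharTSUpTrSplitSlot

end
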